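import Literature.AlgebraicGeometry.Motives.HodgeThetaSubalgebraUnitaryAnnihilatorIdealTop
import HarnessLib

/-!
# The `Θ`-subalgebra theorem beyond coprime multiplicities, IV: the Levi decomposition
# `𝔊₀ = ℂU ⊕ ℂV ⊕ ℂ(E₁ − E₂) ⊕ 𝔰` of a `P`-annihilator-reducible `𝔊` at multiplicities `(2,4)` and the irreducibility
# of `range E₁` under the centraliser `𝔰` (the `𝔰𝔩₂ ⊗ 1 ⊕ 1 ⊗ 𝔰` pattern of Moonen–Zarhin 1999 (2.5) on `Q`;
# classification-free)

Family `hodge`, layer `Literature/AlgebraicGeometry/Motives` (pure complex linear algebra; no geometry). Written for the cell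
`pub-hodgeav-hg6` (req-37 (A) row 2 «base of HC ladder», TABLE X row 8-`(4,2)`, crux `UnitaryThetaCore.top_or_radical_two_four`;
eng-5 lineage g5, brick V2c; honest framing of that cell: HC / HC_AV / HC_CM / H2 NOT proved — THIS file is unconditional linear
algebra and discharges no hypothesis of the cell's cover). UNCONDITIONAL; theorems only — no definition, no named fact (D-0026),
no `sorry`. It is the `W`-level form, for the pair of idempotents `E₁, E₂` refining `Θ`, of the tree's
`SymplecticThetaSix.skeleton_levi` / `SymplecticThetaSix.skeleton_irreducible` (`HodgeThetaSubalgebraSymplecticRankSixSkeleton`,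
cell `pub-hodge-ring2`), whose hypotheses (`P ⊕ Q = M`) do not literally apply on `W = P ⊕ range E₁ ⊕ range E₂`; the
twenty-line arguments are re-run here rather than transported through the Levi restriction algebra.

SETTING (output of bricks V2a `UnitaryFourTwo.exists_levi_data` and V2b `UnitaryFourTwo.lines_of_annP_reducible`, as
hypotheses): `𝔊 ⊆ End(W)` bracket-closed; `Θ`; idempotents `E₁, E₂ ∈ 𝔊` with `E₁ + E₂ = ½(1 − Θ)`, `E₁E₂ = E₂E₁ = 0`,
commuting with `Θ`; the UNIT PAIR `U = E₁UE₂`, `V = E₂VE₁` in `𝔊` with `UV = E₁`, `VU = E₂`; the LINES: `E₁XE₂ ∈ ℂU` and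
`E₂XE₁ ∈ ℂV` for every `Θ`-commuting `X ∈ 𝔊`; the graded parts `E₁XE₂, E₂XE₁ ∈ 𝔊` with `X − E₁XE₂ − E₂XE₁` commuting with
`E₂`; level-one Levi irreducibility of `Q`.

WHAT IS PROVED.
* **`UnitaryFourTwo.levi_decomposition`** — every `Θ`-commuting `X ∈ 𝔊` is `aU + bV + y(E₁ − E₂) + S` with `S ∈ 𝔊`
  commuting with `Θ`, `E₂`, `U` and `V` (`[X₀, U] = λU`, `[X₀, V] = μV`, and `0 = [X₀, [U,V]] = (λ + μ)(E₁ − E₂)`;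
  `S = X₀ − (λ/2)(E₁ − E₂)` since `[E₁ − E₂, U] = 2U`, `[E₁ − E₂, V] = −2V`).
* **`UnitaryFourTwo.centraliser_irreducible`** — a subspace of `range E₁` stable under every `S ∈ 𝔊` commuting with
  `Θ, U, V` is `0` or `range E₁` (`U′ ⊕ VU′` is then stable under all of `𝔊₀`).
SEQUEL: V3 (the skeleton on `W`), V4 (radical of `tr_W − ¾κ`), V5 (assembly of the crux).

## References
* [MoonenZarhin1999LowDim] B. Moonen, Yu. Zarhin, Math. Ann. 315 (1999), §2 (2.3), (2.5).
* [Ribet1983] K. A. Ribet, Amer. J. Math. 105 (1983), Thm. 3.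
* [GoodmanWallachGTM255] R. Goodman, N. Wallach, *Symmetry, Representations, and Invariants*, §4.1.1.
* [Humphreys1972] J. E. Humphreys, *Introduction to Lie Algebras and Representation Theory*, §2.1 (𝔰𝔩₂), §4.1.
-/

noncomputable section

open Module

namespace Literature.AlgebraicGeometry.Motives

namespace HodgeStructure

variable {W : Type*} [AddCommGroup W] [Module ℂ W]

/-- **The Levi decomposition `𝔊₀ = ℂU ⊕ ℂV ⊕ ℂ(E₁ − E₂) ⊕ 𝔰`.** In the SETTING (module docstring), every `Θ`-commuting
`X ∈ 𝔊` can be written `X = aU + bV + y(E₁ − E₂) + S` where `S ∈ 𝔊` commutes with `Θ`, with `E₂`, with `U` and with `V`.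
(Moonen–Zarhin's `𝔰𝔩₂ ⊗ 1 ⊕ 1 ⊗ 𝔰` on `Q`: `⟨V, E₁ − E₂, U⟩ ≅ 𝔰𝔩₂` and `𝔰` its centraliser; the tree's
`SymplecticThetaSix.skeleton_levi` argument.) [cite: MoonenZarhin1999LowDim, §2 (2.3), (2.5)] [cite: Humphreys1972, §2.1] -/
theorem UnitaryFourTwo.levi_decomposition {𝔊 : Submodule ℂ (Module.End ℂ W)}
    (hbr : ∀ Y ∈ 𝔊, ∀ Z ∈ 𝔊, Y * Z - Z * Y ∈ 𝔊) {Θ E₁ E₂ U V : Module.End ℂ W}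
    (hE₁ : E₁ ∈ 𝔊) (hE₂ : E₂ ∈ 𝔊) (hU : U ∈ 𝔊) (hV : V ∈ 𝔊) (hE₁0 : E₁ ≠ 0)
    (hsum : E₁ + E₂ = (2 : ℂ)⁻¹ • (1 - Θ)) (hE₁E₁ : E₁ * E₁ = E₁) (hE₂E₂ : E₂ * E₂ = E₂) (hE₁E₂ : E₁ * E₂ = 0)
    (hE₂E₁ : E₂ * E₁ = 0) (hE₁Θ : E₁ * Θ = Θ * E₁) (hE₂Θ : E₂ * Θ = Θ * E₂) (hUΘ : U * Θ = Θ * U)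
    (hVΘ : V * Θ = Θ * V) (hE₁U : E₁ * U = U) (hUE₂ : U * E₂ = U) (hE₂V : E₂ * V = V) (hVE₁ : V * E₁ = V)
    (hUV : U * V = E₁) (hVU : V * U = E₂)
    (hlineU : ∀ X ∈ 𝔊, X * Θ = Θ * X → ∃ c : ℂ, E₁ * X * E₂ = c • U)
    (hlineV : ∀ X ∈ 𝔊, X * Θ = Θ * X → ∃ c : ℂ, E₂ * X * E₁ = c • V)
    (hgraded : ∀ X ∈ 𝔊, X * Θ = Θ * X →
      E₁ * X * E₂ ∈ 𝔊 ∧ E₂ * X * E₁ ∈ 𝔊 ∧ (X - E₁ * X * E₂ - E₂ * X * E₁) * E₂ = E₂ * (X - E₁ * X * E₂ - E₂ * X * E₁))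
    {X : Module.End ℂ W} (hX : X ∈ 𝔊) (hXΘ : X * Θ = Θ * X) :
    ∃ a b y : ℂ, ∃ S : Module.End ℂ W, S ∈ 𝔊 ∧ X = a • U + b • V + y • (E₁ - E₂) + S ∧ S * Θ = Θ * S ∧
      S * E₂ = E₂ * S ∧ S * U = U * S ∧ S * V = V * S := by
  classical
  -- commutation helpers
  have hcommE₁ : ∀ Y : Module.End ℂ W, Y * Θ = Θ * Y → Y * E₂ = E₂ * Y → Y * E₁ = E₁ * Y := by
    intro Y hYΘ hYE₂
    have h : Y * (E₁ + E₂) = (E₁ + E₂) * Y := by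
      rw [hsum, mul_smul_comm, smul_mul_assoc, mul_sub, sub_mul, mul_one, one_mul, hYΘ]
    rw [mul_add, add_mul, hYE₂] at h
    exact add_right_cancel h
  have hE₂U : E₂ * U = 0 := by rw [← hE₁U, ← mul_assoc, hE₂E₁, zero_mul]
  have hUE₁ : U * E₁ = 0 := by rw [← hUE₂, mul_assoc, hE₂E₁, mul_zero]
  have hE₁V : E₁ * V = 0 := by rw [← hE₂V, ← mul_assoc, hE₁E₂, zero_mul]
  have hVE₂ : V * E₂ = 0 := by rw [← hVE₁, mul_assoc, hE₁E₂, mul_zero]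
  -- the graded parts
  obtain ⟨hXp, hXm, hX₀E₂⟩ := hgraded X hX hXΘ
  obtain ⟨a, ha⟩ := hlineU X hX hXΘ
  obtain ⟨b, hb⟩ := hlineV X hX hXΘ
  set X₀ : Module.End ℂ W := X - E₁ * X * E₂ - E₂ * X * E₁ with hX₀def
  have hX₀𝔊 : X₀ ∈ 𝔊 := Submodule.sub_mem _ (Submodule.sub_mem _ hX hXp) hXm
  have hXpΘ : (E₁ * X * E₂) * Θ = Θ * (E₁ * X * E₂) := by
    rw [mul_assoc, mul_assoc, hE₂Θ, ← mul_assoc X, hXΘ, ← mul_assoc, ← mul_assoc, hE₁Θ, mul_assoc, mul_assoc,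
      mul_assoc]
  have hXmΘ : (E₂ * X * E₁) * Θ = Θ * (E₂ * X * E₁) := by
    rw [mul_assoc, mul_assoc, hE₁Θ, ← mul_assoc X, hXΘ, ← mul_assoc, ← mul_assoc, hE₂Θ, mul_assoc, mul_assoc,
      mul_assoc]
  have hX₀Θ : X₀ * Θ = Θ * X₀ := by rw [hX₀def, sub_mul, sub_mul, mul_sub, mul_sub, hXΘ, hXpΘ, hXmΘ]
  clear_value X₀
  have hX₀E₁ : X₀ * E₁ = E₁ * X₀ := hcommE₁ X₀ hX₀Θ hX₀E₂
  have hXeq : X = a • U + b • V + X₀ := by rw [hX₀def, ha, hb]; abel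
  -- `[X₀, U] = lam U`, `[X₀, V] = μ V`
  have hDU : X₀ * U - U * X₀ ∈ 𝔊 := hbr X₀ hX₀𝔊 U hU
  have hDUΘ : (X₀ * U - U * X₀) * Θ = Θ * (X₀ * U - U * X₀) := by
    rw [sub_mul, mul_sub, mul_assoc, hUΘ, ← mul_assoc, hX₀Θ, mul_assoc, mul_assoc, hX₀Θ, ← mul_assoc U, hUΘ,
      mul_assoc]
  obtain ⟨lam, hlam⟩ := hlineU _ hDU hDUΘ
  have hDUeq : E₁ * (X₀ * U - U * X₀) * E₂ = X₀ * U - U * X₀ := by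
    rw [mul_sub, sub_mul, ← mul_assoc, ← hX₀E₁, mul_assoc X₀ E₁ U, hE₁U, mul_assoc, hUE₂, ← mul_assoc, hE₁U,
      mul_assoc, hX₀E₂, ← mul_assoc, hUE₂]
  rw [hDUeq] at hlam
  have hDV : X₀ * V - V * X₀ ∈ 𝔊 := hbr X₀ hX₀𝔊 V hV
  have hDVΘ : (X₀ * V - V * X₀) * Θ = Θ * (X₀ * V - V * X₀) := by
    rw [sub_mul, mul_sub, mul_assoc, hVΘ, ← mul_assoc, hX₀Θ, mul_assoc, mul_assoc, hX₀Θ, ← mul_assoc V, hVΘ,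
      mul_assoc]
  obtain ⟨μ, hμ⟩ := hlineV _ hDV hDVΘ
  have hDVeq : E₂ * (X₀ * V - V * X₀) * E₁ = X₀ * V - V * X₀ := by
    rw [mul_sub, sub_mul, ← mul_assoc, ← hX₀E₂, mul_assoc X₀ E₂ V, hE₂V, mul_assoc, hVE₁, ← mul_assoc, hE₂V,
      mul_assoc, hX₀E₁, ← mul_assoc, hVE₁]
  rw [hDVeq] at hμ
  -- `0 = [X₀, [U, V]] = (lam + μ)(E₁ − E₂)`
  have hJac : X₀ * (U * V - V * U) - (U * V - V * U) * X₀ =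
      (X₀ * U - U * X₀) * V + U * (X₀ * V - V * X₀) - ((X₀ * V - V * X₀) * U + V * (X₀ * U - U * X₀)) := by
    simp only [mul_sub, sub_mul, mul_assoc]
    abel
  have hzero : X₀ * (U * V - V * U) - (U * V - V * U) * X₀ = 0 := by
    rw [hUV, hVU, mul_sub, sub_mul, hX₀E₁, hX₀E₂, sub_self]
  rw [hzero, hlam, hμ, smul_mul_assoc, mul_smul_comm, smul_mul_assoc, mul_smul_comm, hUV, hVU] at hJac
  have hsumlm : (lam + μ) • (E₁ - E₂) = 0 := by
    rw [add_smul, smul_sub, smul_sub]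
    have h := hJac.symm
    rw [sub_eq_zero] at h
    -- h : lam • E₁ + μ • E₁ = μ • E₂ + lam • E₂
    calc lam • E₁ - lam • E₂ + (μ • E₁ - μ • E₂) = (lam • E₁ + μ • E₁) - (μ • E₂ + lam • E₂) := by abel
      _ = 0 := by rw [h, sub_self]
  have hne : E₁ - E₂ ≠ 0 := by
    intro h0
    apply hE₁0
    have h := congrArg (fun F => E₁ * F) h0
    simp only [mul_sub, hE₁E₁, hE₁E₂, sub_zero, mul_zero] at h
    exact h
  have hlm : lam + μ = 0 := (smul_eq_zero.1 hsumlm).resolve_right hne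
  -- the brackets of `E₁ − E₂` with `U`, `V`
  have hHU : (E₁ - E₂) * U - U * (E₁ - E₂) = (2 : ℂ) • U := by
    rw [sub_mul, mul_sub, hE₁U, hE₂U, hUE₁, hUE₂, two_smul]; abel
  have hHV : (E₁ - E₂) * V - V * (E₁ - E₂) = -((2 : ℂ) • V) := by
    rw [sub_mul, mul_sub, hE₁V, hE₂V, hVE₁, hVE₂, two_smul]; abel
  -- the centraliser element
  set S : Module.End ℂ W := X₀ - ((2 : ℂ)⁻¹ * lam) • (E₁ - E₂) with hSdef
  refine ⟨a, b, (2 : ℂ)⁻¹ * lam, S, ?_, ?_, ?_, ?_, ?_, ?_⟩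
  · exact Submodule.sub_mem _ hX₀𝔊 (Submodule.smul_mem _ _ (Submodule.sub_mem _ hE₁ hE₂))
  · rw [hXeq, hSdef]; abel
  · rw [hSdef, sub_mul, mul_sub, smul_mul_assoc, mul_smul_comm, sub_mul, mul_sub, hE₁Θ, hE₂Θ, hX₀Θ]
  · rw [hSdef, sub_mul, mul_sub, smul_mul_assoc, mul_smul_comm, sub_mul, mul_sub, hE₁E₂, hE₂E₁, hE₂E₂, hX₀E₂]
  · have h : S * U - U * S = 0 := by
      rw [hSdef, sub_mul, mul_sub, smul_mul_assoc, mul_smul_comm]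
      calc X₀ * U - ((2 : ℂ)⁻¹ * lam) • ((E₁ - E₂) * U) - (U * X₀ - ((2 : ℂ)⁻¹ * lam) • (U * (E₁ - E₂)))
          = (X₀ * U - U * X₀) - ((2 : ℂ)⁻¹ * lam) • ((E₁ - E₂) * U - U * (E₁ - E₂)) := by rw [smul_sub]; abel
        _ = 0 := by rw [hlam, hHU]; module
    exact sub_eq_zero.1 h
  · have h : S * V - V * S = 0 := by
      rw [hSdef, sub_mul, mul_sub, smul_mul_assoc, mul_smul_comm]
      calc X₀ * V - ((2 : ℂ)⁻¹ * lam) • ((E₁ - E₂) * V) - (V * X₀ - ((2 : ℂ)⁻¹ * lam) • (V * (E₁ - E₂)))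
          = (X₀ * V - V * X₀) - ((2 : ℂ)⁻¹ * lam) • ((E₁ - E₂) * V - V * (E₁ - E₂)) := by rw [smul_sub]; abel
        _ = 0 := by
          have hμ' : μ = -lam := by linear_combination hlm
          rw [hμ, hHV, hμ']; module
    exact sub_eq_zero.1 h

/-- **`range E₁` is irreducible under the centraliser.** In the SETTING (module docstring) with level-one Levi
irreducibility of `Q`, a subspace `U′ ≤ range E₁` stable under every `S ∈ 𝔊` commuting with `Θ`, `U` and `V` is `0` or
`range E₁`: `U′ ⊕ V(U′) ≤ Q` is stable under `U`, `V`, `E₁ − E₂` and the centraliser, hence (by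
`UnitaryFourTwo.levi_decomposition`) under every `Θ`-commuting element of `𝔊`. (The tree's
`SymplecticThetaSix.skeleton_irreducible` argument.) [cite: MoonenZarhin1999LowDim, §2 (2.5)] [cite: Ribet1983, Thm. 3] -/
theorem UnitaryFourTwo.centraliser_irreducible {𝔊 : Submodule ℂ (Module.End ℂ W)}
    (hbr : ∀ Y ∈ 𝔊, ∀ Z ∈ 𝔊, Y * Z - Z * Y ∈ 𝔊) {Θ E₁ E₂ U V : Module.End ℂ W} (hΘΘ : Θ * Θ = 1)
    {Q : Submodule ℂ W} (hQ : ∀ x, x ∈ Q ↔ Θ x = -x)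
    (hE₁ : E₁ ∈ 𝔊) (hE₂ : E₂ ∈ 𝔊) (hU : U ∈ 𝔊) (hV : V ∈ 𝔊) (hE₁0 : E₁ ≠ 0)
    (hsum : E₁ + E₂ = (2 : ℂ)⁻¹ • (1 - Θ)) (hE₁E₁ : E₁ * E₁ = E₁) (hE₂E₂ : E₂ * E₂ = E₂) (hE₁E₂ : E₁ * E₂ = 0)
    (hE₂E₁ : E₂ * E₁ = 0) (hE₁Θ : E₁ * Θ = Θ * E₁) (hE₂Θ : E₂ * Θ = Θ * E₂) (hUΘ : U * Θ = Θ * U)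
    (hVΘ : V * Θ = Θ * V) (hE₁U : E₁ * U = U) (hUE₂ : U * E₂ = U) (hE₂V : E₂ * V = V) (hVE₁ : V * E₁ = V)
    (hUV : U * V = E₁) (hVU : V * U = E₂)
    (hlineU : ∀ X ∈ 𝔊, X * Θ = Θ * X → ∃ c : ℂ, E₁ * X * E₂ = c • U)
    (hlineV : ∀ X ∈ 𝔊, X * Θ = Θ * X → ∃ c : ℂ, E₂ * X * E₁ = c • V)
    (hgraded : ∀ X ∈ 𝔊, X * Θ = Θ * X →
      E₁ * X * E₂ ∈ 𝔊 ∧ E₂ * X * E₁ ∈ 𝔊 ∧ (X - E₁ * X * E₂ - E₂ * X * E₁) * E₂ = E₂ * (X - E₁ * X * E₂ - E₂ * X * E₁))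
    (hlevi : ∀ U' : Submodule ℂ W, U' ≤ Q → (∀ X ∈ 𝔊, X * Θ = Θ * X → ∀ y ∈ U', X y ∈ U') → U' = ⊥ ∨ U' = Q)
    (U' : Submodule ℂ W) (hU'le : U' ≤ LinearMap.range E₁)
    (hU'st : ∀ S ∈ 𝔊, S * Θ = Θ * S → S * U = U * S → S * V = V * S → ∀ x ∈ U', S x ∈ U') :
    U' = ⊥ ∨ U' = LinearMap.range E₁ := by
  classical
  have hΘΘv : ∀ v, Θ (Θ v) = v := fun v => by rw [← Module.End.mul_apply, hΘΘ, Module.End.one_apply]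
  have hmemR₁ : ∀ x, E₁ x = x ↔ x ∈ LinearMap.range E₁ := fun x =>
    ⟨fun h => ⟨x, h⟩, by rintro ⟨w, rfl⟩; rw [← Module.End.mul_apply, hE₁E₁]⟩
  have hπQmem : ∀ w, ((2 : ℂ)⁻¹ • ((1 : Module.End ℂ W) - Θ)) w ∈ Q := fun w =>
    (hQ _).2 (by rw [LinearMap.smul_apply, LinearMap.sub_apply, Module.End.one_apply, map_smul, map_sub, hΘΘv,
      ← smul_neg, neg_sub])
  have hE₁Q : ∀ w, E₁ w ∈ Q := fun w => by
    have h : E₁ w = (E₁ + E₂) (E₁ w) := by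
      rw [LinearMap.add_apply, ← Module.End.mul_apply, ← Module.End.mul_apply, hE₁E₁, hE₂E₁, LinearMap.zero_apply,
        add_zero]
    rw [h, hsum]; exact hπQmem _
  have hE₂Q : ∀ w, E₂ w ∈ Q := fun w => by
    have h : E₂ w = (E₁ + E₂) (E₂ w) := by
      rw [LinearMap.add_apply, ← Module.End.mul_apply, ← Module.End.mul_apply, hE₁E₂, hE₂E₂, LinearMap.zero_apply,
        zero_add]
    rw [h, hsum]; exact hπQmem _
  have hVQ : ∀ w, V w ∈ Q := fun w => by rw [← hE₂V, Module.End.mul_apply]; exact hE₂Q _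
  have hE₁V : E₁ * V = 0 := by rw [← hE₂V, ← mul_assoc, hE₁E₂, zero_mul]
  have hVV : V * V = 0 := by
    calc V * V = (V * E₁) * (E₂ * V) := by rw [hVE₁, hE₂V]
      _ = 0 := by rw [mul_assoc, ← mul_assoc E₁, hE₁E₂, zero_mul, mul_zero]
  -- the doubled subspace `U'' = U' ⊔ V(U')`
  set U'' : Submodule ℂ W := U' ⊔ U'.map V with hU''def
  have hU''Q : U'' ≤ Q := sup_le (fun x hx => by rw [← (hmemR₁ x).2 (hU'le hx)]; exact hE₁Q x)
    (by rintro _ ⟨x, -, rfl⟩; exact hVQ x)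
  have hst : ∀ X ∈ 𝔊, X * Θ = Θ * X → ∀ y ∈ U'', X y ∈ U'' := by
    intro X hX hXΘ y hy
    obtain ⟨a, b, c, S, hS, hXeq, hSΘ, -, hSU, hSV⟩ := UnitaryFourTwo.levi_decomposition hbr hE₁ hE₂ hU hV hE₁0 hsum
      hE₁E₁ hE₂E₂ hE₁E₂ hE₂E₁ hE₁Θ hE₂Θ hUΘ hVΘ hE₁U hUE₂ hE₂V hVE₁ hUV hVU hlineU hlineV hgraded hX hXΘ
    -- values on `U'` and on `V(U')`
    have hU'x : ∀ x ∈ U', U x = 0 ∧ V x ∈ U'' ∧ (E₁ - E₂) x = x ∧ S x ∈ U' := fun x hx => by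
      have hx1 : E₁ x = x := (hmemR₁ x).2 (hU'le hx)
      refine ⟨?_, Submodule.mem_sup_right (Submodule.mem_map_of_mem hx), ?_, hU'st S hS hSΘ hSU hSV x hx⟩
      · rw [← hUE₂, Module.End.mul_apply, ← hx1, ← Module.End.mul_apply E₂, hE₂E₁, LinearMap.zero_apply, map_zero]
      · rw [LinearMap.sub_apply, hx1, ← hx1, ← Module.End.mul_apply E₂, hE₂E₁, LinearMap.zero_apply, sub_zero]
    have hVx : ∀ x ∈ U', U (V x) = x ∧ V (V x) = 0 ∧ (E₁ - E₂) (V x) = -(V x) ∧ S (V x) ∈ U'' := fun x hx => by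
      have hx1 : E₁ x = x := (hmemR₁ x).2 (hU'le hx)
      refine ⟨by rw [← Module.End.mul_apply, hUV, hx1], ?_, ?_, ?_⟩
      · rw [← Module.End.mul_apply, hVV, LinearMap.zero_apply]
      · rw [LinearMap.sub_apply, ← Module.End.mul_apply, ← Module.End.mul_apply, hE₁V, hE₂V, LinearMap.zero_apply,
          zero_sub]
      · rw [← Module.End.mul_apply, hSV, Module.End.mul_apply]
        exact Submodule.mem_sup_right (Submodule.mem_map_of_mem (hU'st S hS hSΘ hSU hSV x hx))
    have hXU' : ∀ x ∈ U', X x ∈ U'' := fun x hx => by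
      obtain ⟨h1, h2, h3, h4⟩ := hU'x x hx
      rw [hXeq, LinearMap.add_apply, LinearMap.add_apply, LinearMap.add_apply, LinearMap.smul_apply,
        LinearMap.smul_apply, LinearMap.smul_apply, h1, smul_zero, zero_add, h3]
      exact Submodule.add_mem _ (Submodule.add_mem _ (Submodule.smul_mem _ _ h2)
        (Submodule.smul_mem _ _ (Submodule.mem_sup_left hx))) (Submodule.mem_sup_left h4)
    have hXVU' : ∀ x ∈ U', X (V x) ∈ U'' := fun x hx => by
      obtain ⟨h1, h2, h3, h4⟩ := hVx x hx
      rw [hXeq, LinearMap.add_apply, LinearMap.add_apply, LinearMap.add_apply, LinearMap.smul_apply,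
        LinearMap.smul_apply, LinearMap.smul_apply, h1, h2, smul_zero, add_zero, h3, smul_neg, ← sub_eq_add_neg]
      exact Submodule.add_mem _ (Submodule.sub_mem _ (Submodule.smul_mem _ _ (Submodule.mem_sup_left hx))
        (Submodule.smul_mem _ _ (Submodule.mem_sup_right (Submodule.mem_map_of_mem hx)))) h4
    obtain ⟨y₁, hy₁, y₂, hy₂, rfl⟩ := Submodule.mem_sup.1 hy
    obtain ⟨x₂, hx₂, rfl⟩ := Submodule.mem_map.1 hy₂
    rw [map_add]
    exact Submodule.add_mem _ (hXU' y₁ hy₁) (hXVU' x₂ hx₂)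
  rcases hlevi U'' hU''Q hst with h | h
  · left
    rw [eq_bot_iff]
    intro x hx
    have hx' : x ∈ U'' := Submodule.mem_sup_left hx
    rw [h] at hx'
    exact hx'
  · right
    refine le_antisymm hU'le fun y hy => ?_
    have hyQ : y ∈ U'' := by rw [h, ← (hmemR₁ y).2 hy]; exact hE₁Q y
    obtain ⟨y₁, hy₁, y₂, hy₂, hsum'⟩ := Submodule.mem_sup.1 hyQ
    obtain ⟨x₂, hx₂, rfl⟩ := Submodule.mem_map.1 hy₂
    have hy1 : E₁ y = y := (hmemR₁ y).2 hy
    have hy₁1 : E₁ y₁ = y₁ := (hmemR₁ y₁).2 (hU'le hy₁)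
    have hVx₂ : E₁ (V x₂) = 0 := by rw [← Module.End.mul_apply, ← hE₂V, ← mul_assoc, hE₁E₂, zero_mul, LinearMap.zero_apply]
    have h' := congrArg E₁ hsum'
    rw [map_add, hy₁1, hVx₂, add_zero, hy1] at h'
    rw [← h']
    exact hy₁

end HodgeStructure

end Literature.AlgebraicGeometry.Motives

end
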